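import Summits.CriticalPhenomena.PercolationContinuityZ3.Theorems.PercNearOneGluingNoHeavyLowerTailQuantitativeS5MarginPositiveCompat
import Summits.CriticalPhenomena.PercolationContinuityZ3.Theorems.PercNearOneGluingAdditiveGluingSurplusClosure
import HarnessLib

/-!
# The decoy-free (S5) margin is RANK-FREE; strictness criteria may be checked in ANY compatible injective rank

Support file (`--supports stmt-CriticalPhenomena-4575`), prover seat `prim-rate-mine-2` (lane prim-rate, constants-miner (c), BENCH rows
M2-R22′ / M2-R22-NEG-TIE / M2-R25; `run/shared/lean/prim/prim-rate/prim-rate-mine-2/PROOFS.md` §P22).  No definitions, no named facts, no sorries;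
standard axioms.

The lane's exact witness `refutations/M2-R22-TIE.json` (n = 7, a 4-way tie of the relay means) shows that the strictness criterion of row M2-R22 is
RANK-DEPENDENT at ties: for 6 of the 24 compatible injective ranks the criterion fails although the margin is positive.  The margin itself does not
depend on the compatible injective rank — `Sur_u(T)` is the pattern-free min-form (`CSH.surplus_eq_minForm`) — so a criterion verified in ONE
compatible injective rank gives strictness in ALL of them:

* `CSH.s5dMargin_nil_eq_of_compat` — `s5dMargin w T r [] o v F = s5dMargin w T r' [] o v F` for compatible injective `r, r'`;
* `CSH.s5dMargin_nil_pos_of_compat_rank` — if `0 < s5dMargin w T r' [] o v F` for some compatible injective `r'` then the same for every such `r`;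
* `CSH.s5dMargin_nil_pos_of_exists_pivotal_anyRank` — the pivotal criterion of `CSH.s5dMargin_nil_pos_of_exists_pivotal_of_compat` checked in a
  compatible injective rank `r'` of one's choosing (e.g. the one that puts the candidate relay FIRST in its tie class: ties read as later relays,
  the rank-free criterion CRIT⁼ of row M2-R22′) yields strictness for the given rank `r`.
[cite: KozmaNitzan2024, Conj. 4 (p. 32)] [cite: Grimmett1999, §7.3 p. 162]
-/

noncomputable section

namespace Summit.CriticalPhenomena.PercolationContinuityZ3.Theorems

open MeasureTheory Set Literature.Probability.LatticeModels Literature.Probability.Percolation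
open scoped Classical

namespace CSH

variable {n : ℕ}

/-- **The decoy-free (S5) margin does not depend on the compatible injective rank.** [cite: KozmaNitzan2024, Conj. 4 (p. 32)] -/
theorem s5dMargin_nil_eq_of_compat (w : Sym2 (Fin n) → unitInterval) (T : Finset (Fin n)) (r r' : Fin n → ℕ) (o v : Fin n)
    (F : Set (Fin n) → ℝ) (hr : Set.InjOn r ↑T) (hr' : Set.InjOn r' ↑T)
    (hcompat : ∀ a ∈ T, ∀ a' ∈ T, r a < r a' →
      ∫ ω, F (openCluster ω a) ∂(prodBernoulli w) ≤ ∫ ω, F (openCluster ω a') ∂(prodBernoulli w))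
    (hcompat' : ∀ a ∈ T, ∀ a' ∈ T, r' a < r' a' →
      ∫ ω, F (openCluster ω a) ∂(prodBernoulli w) ≤ ∫ ω, F (openCluster ω a') ∂(prodBernoulli w)) :
    s5dMargin w T r [] o v F = s5dMargin w T r' [] o v F := by
  rw [s5dMargin_nil, s5dMargin_nil, surplus_eq_minForm w T r F o hr hcompat, surplus_eq_minForm w T r' F o hr' hcompat',
    surplus_eq_minForm w T r F v hr hcompat, surplus_eq_minForm w T r' F v hr' hcompat']

/-- **Strictness transfers between compatible injective ranks.** [cite: KozmaNitzan2024, Conj. 4 (p. 32)] -/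
theorem s5dMargin_nil_pos_of_compat_rank (w : Sym2 (Fin n) → unitInterval) (T : Finset (Fin n)) (r r' : Fin n → ℕ) (o v : Fin n)
    (F : Set (Fin n) → ℝ) (hr : Set.InjOn r ↑T) (hr' : Set.InjOn r' ↑T)
    (hcompat : ∀ a ∈ T, ∀ a' ∈ T, r a < r a' →
      ∫ ω, F (openCluster ω a) ∂(prodBernoulli w) ≤ ∫ ω, F (openCluster ω a') ∂(prodBernoulli w))
    (hcompat' : ∀ a ∈ T, ∀ a' ∈ T, r' a < r' a' →
      ∫ ω, F (openCluster ω a) ∂(prodBernoulli w) ≤ ∫ ω, F (openCluster ω a') ∂(prodBernoulli w))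
    (hpos : 0 < s5dMargin w T r' [] o v F) : 0 < s5dMargin w T r [] o v F := by
  rwa [s5dMargin_nil_eq_of_compat w T r r' o v F hr hr' hcompat hcompat']

/-- **The pivotal criterion checked in ANY compatible injective rank gives strictness** (rank-free reading of row M2-R22 ⟸; with `r'` putting the
candidate relay first in its tie class this is «CRIT⁼ ⟹ strict» of row M2-R22′).  Weights non-degenerate on `E`; `o ≠ v` off `T`; `r, r'` compatible
injective ranks; a relay `a` and a pair of `E − pairs(T_{<a}(r'))` pivotal for `{a↔b}` and for `{o ↔ {a} ∪ T_{>a}(r')} ∪ {o↔v}` ⟹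
`0 < s5dMargin w T r [] o v 1{b ∈ ·}`. [cite: KozmaNitzan2024, Conj. 4 (p. 32)] [cite: Harris1960, Lemma 4.1 (p. 16)] -/
theorem s5dMargin_nil_pos_of_exists_pivotal_anyRank (w : Sym2 (Fin n) → unitInterval) (E : Set (Sym2 (Fin n)))
    (hE0 : ∀ f, f ∉ E → (w f : ℝ) = 0) (hE1 : ∀ f ∈ E, 0 < (w f : ℝ) ∧ (w f : ℝ) < 1) (o v b : Fin n)
    (hov : o ≠ v) (T : Finset (Fin n)) (r r' : Fin n → ℕ) (hr : Set.InjOn r ↑T) (hr' : Set.InjOn r' ↑T)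
    (hcompat : ∀ a ∈ T, ∀ a' ∈ T, r a < r a' →
      ∫ ω, (fun S : Set (Fin n) => if b ∈ S then (1 : ℝ) else 0) (openCluster ω a) ∂(prodBernoulli w) ≤
        ∫ ω, (fun S : Set (Fin n) => if b ∈ S then (1 : ℝ) else 0) (openCluster ω a') ∂(prodBernoulli w))
    (hcompat' : ∀ a ∈ T, ∀ a' ∈ T, r' a < r' a' →
      ∫ ω, (fun S : Set (Fin n) => if b ∈ S then (1 : ℝ) else 0) (openCluster ω a) ∂(prodBernoulli w) ≤
        ∫ ω, (fun S : Set (Fin n) => if b ∈ S then (1 : ℝ) else 0) (openCluster ω a') ∂(prodBernoulli w))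
    (hoT : o ∉ T) (hvT : v ∉ T) (a : Fin n) (ha : a ∈ T)
    (hcrit : ∃ e ∈ E, (∀ y ∈ T.filter (fun b' => r' b' < r' a), y ∉ e) ∧
      (∃ η : Set (Sym2 (Fin n)), η ⊆ {f | f ∈ E ∧ ∀ y ∈ T.filter (fun b' => r' b' < r' a), y ∉ f} ∧
        insert e η ∈ (openConn a b : Set (BondConfig (Fin n))) ∧ η \ {e} ∉ (openConn a b : Set (BondConfig (Fin n)))) ∧
      (∃ η : Set (Sym2 (Fin n)), η ⊆ {f | f ∈ E ∧ ∀ y ∈ T.filter (fun b' => r' b' < r' a), y ∉ f} ∧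
        insert e η ∈ (((⋃ t ∈ (insert a (T.filter (fun b' => r' a < r' b') ∪ ([] : List (Fin n)).toFinset)), openConn o t) ∪ openConn o v :
          Set (BondConfig (Fin n)))) ∧
        η \ {e} ∉ (((⋃ t ∈ (insert a (T.filter (fun b' => r' a < r' b') ∪ ([] : List (Fin n)).toFinset)), openConn o t) ∪ openConn o v :
          Set (BondConfig (Fin n)))))) :
    0 < s5dMargin w T r [] o v (fun S : Set (Fin n) => if b ∈ S then (1 : ℝ) else 0) :=
  s5dMargin_nil_pos_of_compat_rank w T r r' o v _ hr hr' hcompat hcompat'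
    (s5dMargin_nil_pos_of_exists_pivotal_of_compat w E hE0 hE1 o v b hov T r' hr' hcompat' hoT hvT a ha hcrit)

end CSH

end Summit.CriticalPhenomena.PercolationContinuityZ3.Theorems
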